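import Summits.ResolutionOfSingularities.ResolutionOfSingularities.Theorems.EquisingularLiftEquisingularLiftNatDirStepUnobsHostChange
import HarnessLib

/-!
# [OURS · L1 W4.5(b) · EL♮(3) · NEST host kit, brick (L4)] `DirStepUnobs` at host `univ` ALONG ISOMORPHISMS, and
# «ONE MODEL ISOMORPHISM GIVES ALL»: the `∀e` hypothesis of the fresh-plane door from a single model certificate

Cell `res-hironaka`, LADDER-RESOLUTION rung L (D-0089), slot W4.5(b), crux chain w45b: child crux **EL♮(3)** = stmt-ResolutionOfSingularities-20148.
WIDTH seat res-L1-w45b-iso-w4 g2 (D-0157 DOOR 1), free hand (certificate currency of WIDTH TABLES D3/D4: desk R42 (5), BOOKED l.≈83063).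
`--supports stmt-ResolutionOfSingularities-20148 --as helper`. OURS; NOT a statement of H. Hironaka's 2017 manuscript (nothing of [Hironaka2017] is
asserted); AI-written, and AI review is weaker than expert review. DEF-FREE; no `sorry`; standard axioms. EL♮(3) is NOT proved here; resolution of
singularities in positive characteristic is NOT proved here (dimension 3 is Cossart–Piltant 2008/2009 in print); counted 0 toward the summit.

WHY. res-L1-w45b-iso-w2's fresh-plane door ✓ `dirStepUnobs_freshPlane_of_forall_model` (p656762) consumes a MODEL statement quantified over EVERY
field `R` and EVERY isomorphism `e : ℙ²_R ≅ Ẽ_x` («`DirStepUnobs ℙ²_R univ _ (e⁻¹ Z) _`»), while the model certificates are proved in ONE frame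
(the conic ✓ `S10Conic.dirStepUnobs_conic`, iso-w2's lines / plane curves, …). This file closes that gap ABSTRACTLY, with no projective geometry:
`DirStepUnobs` at host `univ` moves along any isomorphism of reduced schemes, so ONE isomorphism `e₀ : P₀ ≅ W` with a certificate for `e₀⁻¹ Z` yields
the certificate for `e⁻¹ Z` for EVERY `e : P ≅ W` (transport along `e₀ ≫ e⁻¹`).

WHAT.
* ★ `dirStepUnobs_image_of_iso` — `P, Q` reduced, `φ : P ≅ Q`, `Γ ⊆ P` closed: `DirStepUnobs P univ _ Γ _ → DirStepUnobs Q univ _ (φ '' Γ) _`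
  (B0 `dirStepUnobs_transport` + the host kit's `exists_isIso_redSub_univ_over`, `exists_isIso_redSub_image`; the step `h1` inside iso-w2's (H2)).
* `dirStepUnobs_preimage_of_iso` — the same with `φ.inv ⁻¹' Γ = φ.hom '' Γ`.
* ★★ `dirStepUnobs_preimage_of_one_model` — «ONE MODEL ISOMORPHISM GIVES ALL»: `W` reduced, `Z ⊆ W` closed, `e₀ : P₀ ≅ W` with
  `DirStepUnobs P₀ univ _ (e₀⁻¹ Z) _`; then for every reduced `P` and every `e : P ≅ W`: `DirStepUnobs P univ _ (e⁻¹ Z) _`. Feeding it `P := ℙ²_R`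
  discharges the `hmodel` binder of ✓ p656762 from a single explicit chart isomorphism of the customer (S10's `Γ_q`, the NEST lines `ℓ_x` of D4).

References (index only): R. Hartshorne, *Algebraic Geometry* (1977), III.5 [cite: Hartshorne1977].
-/

set_option linter.dupNamespace false

noncomputable section

-- `TopCat.Presheaf`/`Scheme.Modules` are not reducible (as in Mathlib's `AlgebraicGeometry/Modules`).
set_option backward.isDefEq.respectTransparency false

open CategoryTheory AlgebraicGeometry

namespace Summit.ResolutionOfSingularities.ResolutionOfSingularities.Cruxes.EquisingularLiftNat.Sections

/-- ★ **`DirStepUnobs` at host `univ` along an isomorphism of reduced schemes**: `φ : P ≅ Q`, `Γ ⊆ P` closed, then unobstructedness of `Γ` in `P`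
gives unobstructedness of `φ(Γ)` in `Q` (any closedness witness). [OURS · L1 W4.5b · EL♮(3) · host kit (L4); NOT a statement of the manuscript] -/
theorem dirStepUnobs_image_of_iso {P Q : Scheme.{0}} [IsReduced P] [IsReduced Q] (φ : P ≅ Q) {Γ : Set P} (hΓ : IsClosed Γ)
    (h : DirStepUnobs P Set.univ isClosed_univ Γ hΓ) (hc : IsClosed ((φ.hom : P → Q) '' Γ)) :
    DirStepUnobs Q Set.univ isClosed_univ ((φ.hom : P → Q) '' Γ) hc := by
  obtain ⟨ε, hε, hεiso⟩ := exists_isIso_redSub_univ_over φ.hom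
  haveI := hεiso
  obtain ⟨hc', εZ, hεZ, hεZiso⟩ := exists_isIso_redSub_image φ.hom (E := Set.univ) isClosed_univ isClosed_univ ε hε hΓ (Set.subset_univ _)
  exact dirStepUnobs_transport P Set.univ isClosed_univ Γ hΓ Q φ.hom Set.univ isClosed_univ _ hc ε εZ
    (Set.subset_univ _) (Set.subset_univ _) hεiso hε hεZiso hεZ h

/-- For an isomorphism `φ : P ≅ Q`, `φ⁻¹ ⁻¹' Γ = φ '' Γ` on points. [folklore] -/
theorem preimage_inv_eq_image_hom {P Q : Scheme.{0}} (φ : P ≅ Q) (Γ : Set P) :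
    (φ.inv : Q → P) ⁻¹' Γ = (φ.hom : P → Q) '' Γ := by
  ext y
  constructor
  · intro hy
    refine ⟨φ.inv y, hy, ?_⟩
    change (φ.inv ≫ φ.hom : Q ⟶ Q) y = y
    rw [Iso.inv_hom_id]; rfl
  · rintro ⟨x, hx, rfl⟩
    change (φ.hom ≫ φ.inv : P ⟶ P) x ∈ Γ
    rw [Iso.hom_inv_id]; exact hx

/-- **`DirStepUnobs` at host `univ`, preimage form**: `φ : P ≅ Q` of reduced schemes, `Γ ⊆ P` closed and unobstructed ⟹ `φ⁻¹ ⁻¹' Γ ⊆ Q` is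
unobstructed. [OURS · L1 W4.5b · EL♮(3) · host kit (L4); NOT a statement of the manuscript] -/
theorem dirStepUnobs_preimage_of_iso {P Q : Scheme.{0}} [IsReduced P] [IsReduced Q] (φ : P ≅ Q) {Γ : Set P} (hΓ : IsClosed Γ)
    (h : DirStepUnobs P Set.univ isClosed_univ Γ hΓ) (hc : IsClosed ((φ.inv : Q → P) ⁻¹' Γ)) :
    DirStepUnobs Q Set.univ isClosed_univ ((φ.inv : Q → P) ⁻¹' Γ) hc := by
  have hc' : IsClosed ((φ.hom : P → Q) '' Γ) := by rw [← preimage_inv_eq_image_hom]; exact hc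
  exact (dirStepUnobs_congr_set (preimage_inv_eq_image_hom φ Γ)).2 (dirStepUnobs_image_of_iso φ hΓ h hc')

/-- ★★ **ONE MODEL ISOMORPHISM GIVES ALL.** `W` a reduced scheme, `Z ⊆ W` closed, `e₀ : P₀ ≅ W` ONE isomorphism from a reduced model with
`DirStepUnobs P₀ univ _ (e₀⁻¹ Z) _` (a model certificate read in the customer's explicit chart). Then for EVERY reduced `P` and EVERY isomorphism
`e : P ≅ W`: `DirStepUnobs P univ _ (e⁻¹ Z) _` — transport along `e₀ ≫ e⁻¹ : P₀ ≅ P`. With `P := ℙ²_R` this is the `∀ R e` model hypothesis of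
res-L1-w45b-iso-w2's fresh-plane door `dirStepUnobs_freshPlane_of_forall_model` (✓ p656762).
[OURS · L1 W4.5b · EL♮(3) · host kit (L4); NOT a statement of the manuscript] -/
theorem dirStepUnobs_preimage_of_one_model {W : Scheme.{0}} [IsReduced W] (Z : Set W)
    {P₀ : Scheme.{0}} [IsReduced P₀] (e₀ : P₀ ≅ W) (hZ₀ : IsClosed ((e₀.hom : P₀ → W) ⁻¹' Z))
    (h₀ : DirStepUnobs P₀ Set.univ isClosed_univ ((e₀.hom : P₀ → W) ⁻¹' Z) hZ₀)
    {P : Scheme.{0}} [IsReduced P] (e : P ≅ W) (hZ : IsClosed ((e.hom : P → W) ⁻¹' Z)) :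
    DirStepUnobs P Set.univ isClosed_univ ((e.hom : P → W) ⁻¹' Z) hZ := by
  -- `e ⁻¹' Z = (e₀ ≫ e⁻¹) '' (e₀ ⁻¹' Z)`
  have hset : ((e₀ ≪≫ e.symm).hom : P₀ → P) '' ((e₀.hom : P₀ → W) ⁻¹' Z) = (e.hom : P → W) ⁻¹' Z := by
    ext y
    constructor
    · rintro ⟨x, hx, rfl⟩
      change (e₀.hom ≫ e.inv ≫ e.hom : P₀ ⟶ W) x ∈ Z
      rw [Iso.inv_hom_id, Category.comp_id]; exact hx
    · intro hy
      refine ⟨(e.hom ≫ e₀.inv : P ⟶ P₀) y, ?_, ?_⟩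
      · change (e.hom ≫ e₀.inv ≫ e₀.hom : P ⟶ W) y ∈ Z
        rw [Iso.inv_hom_id, Category.comp_id]; exact hy
      · change ((e.hom ≫ e₀.inv) ≫ e₀.hom ≫ e.inv : P ⟶ P) y = y
        rw [Category.assoc, Iso.inv_hom_id_assoc, Iso.hom_inv_id]; rfl
  have hc : IsClosed (((e₀ ≪≫ e.symm).hom : P₀ → P) '' ((e₀.hom : P₀ → W) ⁻¹' Z)) := by rw [hset]; exact hZ
  exact (dirStepUnobs_congr_set hset).1 (dirStepUnobs_image_of_iso (e₀ ≪≫ e.symm) hZ₀ h₀ hc)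

end Summit.ResolutionOfSingularities.ResolutionOfSingularities.Cruxes.EquisingularLiftNat.Sections

end
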